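import Literature.AlgebraicGeometry.ShimuraVarieties.UnitaryBallQuotientDatum
import Mathlib.NumberTheory.NumberField.CMField
import Mathlib.Analysis.Complex.Basic
import Mathlib.Tactic.Module
import HarnessLib

/-!
# A Pell unit on an anti-hermitian frame is an elliptic–hyperbolic generator in `U(J)`

Topic `Literature/NumberTheory/Automorphic`, namespace `Literature.NumberTheory.Automorphic.UnitaryGroup`.  Cell `hodgecm-mathlib`,
FLOOR 0, crux item stmt-HodgeConjecture-24832 (hLiu418), E-line socket `stub_SIG` (line L5), organ `stub_GEN : SigGEN` of the L5 closer
skeleton v2 (LA5-plan (g0)) — «∃ an INTEGRAL, determinant-`1`, elliptic-at-`ι₁`, hyperbolic-at-`σ` element of `U(J)`».  This file is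
the GLUE of its sub-cut GEN = FRAME + PELL + glue (LA5-p02 (g0) 02:3xZ): it turns a FRAME (an integral traceless `J`-anti-self-adjoint
`X₀` with `X₀² = D·1`, `D ∈ 𝓞_{F⁺}`, `ι₁ D < 0 < σ D`) and a PELL UNIT (`x, y ∈ 𝓞_{F⁺}`, `y ≠ 0`, `x² − D y² = 1`) into the generator
`g := x·1 + y·X₀`.  THEOREMS ONLY (no definition, no named fact, no instance, no `sorry`).

THE MATHEMATICS (folklore; [PlatonovRapinchuk1994] §4.1, §5.1 for the arithmetic setting).  With `X₀* := (c X₀)ᵀ` and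
`X₀* J = −J X₀`, `tr X₀ = 0`, `X₀² = D`:  `det(x + yX₀) = x² + xy·tr X₀ + y²·det X₀ = x² − D y² = 1`;
`(x + yX₀)* J (x + yX₀) = J (x − yX₀)(x + yX₀) = J (x² − y² D) = J` (as `x, y` are `c`-fixed scalars); `tr (x + yX₀) = 2x ∈ F⁺`;
at a complex embedding `φ` with `φ D` real: `(φ x)² = 1 + (φ D)(φ y)²` with `φ y ≠ 0` real, so `|φ x| < 1` where `φ D < 0` (elliptic:
`‖φ tr‖ < 2`) and `|φ x| > 1` where `φ D > 0` (hyperbolic: `‖φ tr‖ > 2`).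

WHAT IS PROVED.
* `exists_generator_of_frame_of_pell` — the glue above, concluding VERBATIM the `∃ (g) (G), …` body of the skeleton letter `SigGEN`
  (six conjuncts: `g ∈ unitaryGroup c J`, `G.map (algebraMap (𝓞 F) F) = g`, `det g = 1`, `c (tr g) = tr g`, `‖ι₁ (tr g)‖ < 2`,
  `2 < ‖σ (tr g)‖`).
NOT HERE: the FRAME (existence of `X₀`, `D` from the two indefinite places — LA5-p02's next file) and the PELL UNIT (Dirichlet's unit
theorem in `F⁺(√D)`, LA5-p01).  HC_CM is proved only modulo the printed citations until rung 0 closes; no named fact here.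
-/

set_option autoImplicit false

noncomputable section

open NumberField Matrix
open scoped Matrix ComplexOrder ComplexConjugate
open Literature.AlgebraicGeometry.ShimuraVarieties

namespace Literature.NumberTheory.Automorphic.UnitaryGroup

/-- Cayley–Hamilton, `2 × 2`: `A·A = (tr A)·A − (det A)·1` (private copy; the `ℝ`-case is ★ `mul_self_eq_trace_smul_sub_det_smul`
of `ShimuraCurveFiniteVolume`). [folklore] -/
private theorem mul_self_eq_trace_smul_sub_det_smul' {R : Type*} [CommRing R] (A : Matrix (Fin 2) (Fin 2) R) :
    A * A = A.trace • A - A.det • (1 : Matrix (Fin 2) (Fin 2) R) := by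
  ext i j
  fin_cases i <;> fin_cases j <;>
    simp [Matrix.mul_apply, Fin.sum_univ_two, Matrix.trace_fin_two, Matrix.det_fin_two] <;> ring

/-- A `c`-fixed element of a CM field is real under every complex embedding. [folklore] -/
private theorem ofReal_re_eq_of_complexConj_eq {F : Type} [Field F] [NumberField F] [IsCMField F] (φ : F →+* ℂ) {a : F}
    (ha : IsCMField.complexConj F a = a) : ((φ a).re : ℂ) = φ a := by
  rw [← Complex.conj_eq_iff_re, ← IsCMField.complexEmbedding_complexConj F φ a, ha]

/-- **A PELL UNIT ON AN ANTI-HERMITIAN FRAME IS AN ELLIPTIC–HYPERBOLIC GENERATOR** (glue of organ `stub_GEN`, line L5 of crux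
hLiu418).  Let `F` be a CM field with complex conjugation `c`, `J ∈ M₂(F)`, `X₀ ∈ M₂(𝓞_F)` with `(c X₀)ᵀ J = −J X₀`
(`J`-anti-self-adjoint), `X₀² = D·1`, `tr X₀ = 0`, where `D ∈ 𝓞_F` is `c`-fixed with `ι₁ D < 0 < σ D` (real parts; both are real),
and let `x, y ∈ 𝓞_F` be `c`-fixed with `x² − D y² = 1`, `y ≠ 0`.  Then `g := x·1 + y·X₀` is an INTEGRAL element of `U(J)`
(★ `unitaryGroup c J`) of determinant `1` with `c`-fixed trace `2x`, ELLIPTIC at `ι₁` (`‖ι₁ tr g‖ < 2`) and HYPERBOLIC at `σ`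
(`2 < ‖σ tr g‖`) — verbatim the `∃ (g) (G), …` body of the L5 skeleton letter `SigGEN`.
[cite: PlatonovRapinchuk1994, §4.1 and §5.1] -/
theorem exists_generator_of_frame_of_pell
    (F : Type) [Field F] [NumberField F] [IsCMField F] (ι₁ σ : F →+* ℂ) (J : Matrix (Fin 2) (Fin 2) F)
    (X₀ : Matrix (Fin 2) (Fin 2) (𝓞 F)) (D x y : 𝓞 F)
    (hX : ((X₀.map (algebraMap (𝓞 F) F)).map
        ((IsCMField.complexConj F : F ≃ₐ[↥(maximalRealSubfield F)] F) : F →+* F))ᵀ * J =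
      -(J * X₀.map (algebraMap (𝓞 F) F)))
    (hX2 : X₀ * X₀ = D • (1 : Matrix (Fin 2) (Fin 2) (𝓞 F))) (htrX : X₀.trace = 0)
    (hD : IsCMField.complexConj F (algebraMap (𝓞 F) F D) = algebraMap (𝓞 F) F D)
    (hx : IsCMField.complexConj F (algebraMap (𝓞 F) F x) = algebraMap (𝓞 F) F x)
    (hy : IsCMField.complexConj F (algebraMap (𝓞 F) F y) = algebraMap (𝓞 F) F y)
    (hpell : x ^ 2 - D * y ^ 2 = 1) (hy0 : y ≠ 0)
    (hι : (ι₁ (algebraMap (𝓞 F) F D)).re < 0) (hσ : 0 < (σ (algebraMap (𝓞 F) F D)).re) :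
    ∃ (g : GL (Fin 2) F) (G : Matrix (Fin 2) (Fin 2) (𝓞 F)),
      g ∈ unitaryGroup ((IsCMField.complexConj F : F ≃ₐ[↥(maximalRealSubfield F)] F) : F →+* F) J ∧
      G.map (algebraMap (𝓞 F) F) = (g : Matrix (Fin 2) (Fin 2) F) ∧
      (g : Matrix (Fin 2) (Fin 2) F).det = 1 ∧
      IsCMField.complexConj F (g : Matrix (Fin 2) (Fin 2) F).trace = (g : Matrix (Fin 2) (Fin 2) F).trace ∧
      ‖ι₁ (g : Matrix (Fin 2) (Fin 2) F).trace‖ < 2 ∧ 2 < ‖σ (g : Matrix (Fin 2) (Fin 2) F).trace‖ := by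
  classical
  set alg : 𝓞 F →+* F := algebraMap (𝓞 F) F with halg
  set Xf : Matrix (Fin 2) (Fin 2) F := X₀.map alg with hXf
  set x' : F := alg x with hx'
  set y' : F := alg y with hy'
  set D' : F := alg D with hD'
  -- the frame relations over `F`
  have hXf2 : Xf * Xf = D' • (1 : Matrix (Fin 2) (Fin 2) F) := by
    have := congrArg (fun M : Matrix (Fin 2) (Fin 2) (𝓞 F) => M.map alg) hX2
    rw [Matrix.map_mul] at this
    rw [this]
    ext i j
    simp [Matrix.map_apply, Matrix.smul_apply, Matrix.one_apply, apply_ite alg, hD']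
  have htrXf : Xf.trace = 0 := by
    have : Xf.trace = alg X₀.trace := by
      simp [hXf, Matrix.trace_fin_two, Matrix.map_apply]
    rw [this, htrX, map_zero]
  have hdetXf : Xf.det = -D' := by
    have h := mul_self_eq_trace_smul_sub_det_smul' Xf
    rw [htrXf, zero_smul, zero_sub, hXf2] at h
    have h00 := congr_fun (congr_fun h 0) 0
    simp [Matrix.smul_apply] at h00
    rw [h00, neg_neg]
  have hpell' : x' ^ 2 - D' * y' ^ 2 = 1 := by
    have := congrArg alg hpell
    simpa [map_sub, map_pow, map_mul, map_one] using this
  -- the generator `A = x·1 + y·X₀` over `F` and its integral model `G`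
  set A : Matrix (Fin 2) (Fin 2) F := x' • (1 : Matrix (Fin 2) (Fin 2) F) + y' • Xf with hA
  have hdetA : A.det = 1 := by
    have : A.det = x' ^ 2 + x' * y' * Xf.trace + y' ^ 2 * Xf.det := by
      simp [hA, Matrix.det_fin_two, Matrix.trace_fin_two, Matrix.add_apply, Matrix.smul_apply]
      ring
    rw [this, htrXf, hdetXf]
    linear_combination hpell'
  let g : GL (Fin 2) F := Matrix.GeneralLinearGroup.mkOfDetNeZero A (by rw [hdetA]; exact one_ne_zero)
  have hgA : (g : Matrix (Fin 2) (Fin 2) F) = A := rfl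
  set G : Matrix (Fin 2) (Fin 2) (𝓞 F) := x • (1 : Matrix (Fin 2) (Fin 2) (𝓞 F)) + y • X₀ with hG
  have hGA : G.map alg = A := by
    ext i j
    simp [hG, hA, hXf, hx', hy', Matrix.map_apply, Matrix.add_apply, Matrix.smul_apply, Matrix.one_apply, apply_ite alg]
  have htrA : A.trace = 2 * x' := by
    rw [hA, Matrix.trace_add, Matrix.trace_smul, Matrix.trace_smul, Matrix.trace_one, htrXf, smul_zero, add_zero,
      Fintype.card_fin, smul_eq_mul]
    push_cast
    ring
  -- realness at the embeddings
  have hxι := ofReal_re_eq_of_complexConj_eq ι₁ hx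
  have hyι := ofReal_re_eq_of_complexConj_eq ι₁ hy
  have hDι := ofReal_re_eq_of_complexConj_eq ι₁ hD
  have hxσ := ofReal_re_eq_of_complexConj_eq σ hx
  have hyσ := ofReal_re_eq_of_complexConj_eq σ hy
  have hDσ := ofReal_re_eq_of_complexConj_eq σ hD
  have hy'0 : y' ≠ 0 := fun h => hy0 (RingOfIntegers.coe_injective (by rw [map_zero]; exact h))
  -- the Pell relation at an embedding, in real coordinates
  have hpellφ : ∀ φ : F →+* ℂ, ((φ x').re : ℂ) = φ x' → ((φ y').re : ℂ) = φ y' → ((φ D').re : ℂ) = φ D' →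
      (φ x').re ^ 2 = 1 + (φ D').re * (φ y').re ^ 2 ∧ (φ y').re ≠ 0 := by
    intro φ hxφ hyφ hDφ
    have h := congrArg φ hpell'
    rw [map_sub, map_mul, map_pow, map_pow, map_one, ← hxφ, ← hyφ, ← hDφ] at h
    refine ⟨?_, ?_⟩
    · have h' : (((φ x').re ^ 2 - (φ D').re * (φ y').re ^ 2 : ℝ) : ℂ) = (1 : ℝ) := by push_cast; exact h
      have := Complex.ofReal_injective h'
      linarith
    · intro h0
      apply hy'0
      apply φ.injective
      rw [map_zero, ← hyφ, h0, Complex.ofReal_zero]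
  refine ⟨g, G, ?_, hGA, hdetA, ?_, ?_, ?_⟩
  · -- `g ∈ U(J)`
    rw [Literature.AlgebraicGeometry.ShimuraVarieties.mem_unitaryGroup_iff, hgA]
    have hAc : (A.map ((IsCMField.complexConj F : F ≃ₐ[↥(maximalRealSubfield F)] F) : F →+* F))ᵀ =
        x' • (1 : Matrix (Fin 2) (Fin 2) F) +
          y' • ((Xf.map ((IsCMField.complexConj F : F ≃ₐ[↥(maximalRealSubfield F)] F) : F →+* F))ᵀ) := by
      ext i j
      simp [hA, Matrix.map_apply, Matrix.transpose_apply, Matrix.add_apply, Matrix.smul_apply, Matrix.one_apply,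
        apply_ite (IsCMField.complexConj F), hx, hy, eq_comm]
    have hprod : (x' • (1 : Matrix (Fin 2) (Fin 2) F) - y' • Xf) * (x' • 1 + y' • Xf) = 1 := by
      have hexp : (x' • (1 : Matrix (Fin 2) (Fin 2) F) - y' • Xf) * (x' • 1 + y' • Xf) =
          (x' * x') • (1 : Matrix (Fin 2) (Fin 2) F) + (x' * y') • Xf - (y' * x') • Xf - (y' * y') • (Xf * Xf) := by
        rw [sub_mul, mul_add, mul_add, smul_mul_smul_comm, smul_mul_smul_comm, smul_mul_smul_comm, smul_mul_smul_comm,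
          one_mul, one_mul, mul_one]
        abel
      rw [hexp, hXf2, smul_smul]
      conv_rhs => rw [← one_smul F (1 : Matrix (Fin 2) (Fin 2) F), ← hpell']
      module
    calc (A.map ((IsCMField.complexConj F : F ≃ₐ[↥(maximalRealSubfield F)] F) : F →+* F))ᵀ * J * A
        = (x' • (1 : Matrix (Fin 2) (Fin 2) F) +
            y' • ((Xf.map ((IsCMField.complexConj F : F ≃ₐ[↥(maximalRealSubfield F)] F) : F →+* F))ᵀ)) * J * A := by
          rw [hAc]
      _ = (x' • J + y' • (((Xf.map ((IsCMField.complexConj F : F ≃ₐ[↥(maximalRealSubfield F)] F) : F →+* F))ᵀ) * J)) * A := by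
          rw [add_mul, smul_mul_assoc, smul_mul_assoc, one_mul]
      _ = (J * (x' • (1 : Matrix (Fin 2) (Fin 2) F) - y' • Xf)) * A := by
          rw [hX, Matrix.mul_sub, mul_smul_comm, mul_smul_comm, mul_one, smul_neg, sub_eq_add_neg]
      _ = J := by rw [Matrix.mul_assoc, hA, hprod, Matrix.mul_one]
  · -- `c`-fixed trace
    rw [hgA, htrA, map_mul, map_ofNat, hx]
  · -- elliptic at `ι₁`
    obtain ⟨hsq, hb⟩ := hpellφ ι₁ hxι hyι hDι
    have hlt : (ι₁ x').re ^ 2 < 1 := by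
      rw [hsq]
      have : 0 < (ι₁ y').re ^ 2 := by positivity
      have hι' : (ι₁ D').re < 0 := hι
      nlinarith
    have habs : |(ι₁ x').re| < 1 := by
      rw [← sq_lt_one_iff_abs_lt_one]
      exact hlt
    rw [hgA, htrA, map_mul, map_ofNat, ← hxι, ← Complex.ofReal_ofNat, ← Complex.ofReal_mul, Complex.norm_real,
      Real.norm_eq_abs, abs_mul, abs_two]
    linarith
  · -- hyperbolic at `σ`
    obtain ⟨hsq, hb⟩ := hpellφ σ hxσ hyσ hDσ
    have hlt : 1 < (σ x').re ^ 2 := by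
      rw [hsq]
      have : 0 < (σ y').re ^ 2 := by positivity
      have hσ' : 0 < (σ D').re := hσ
      nlinarith
    have habs : 1 < |(σ x').re| := by
      rw [← one_lt_sq_iff_one_lt_abs]
      exact hlt
    rw [hgA, htrA, map_mul, map_ofNat, ← hxσ, ← Complex.ofReal_ofNat, ← Complex.ofReal_mul, Complex.norm_real,
      Real.norm_eq_abs, abs_mul, abs_two]
    linarith

end Literature.NumberTheory.Automorphic.UnitaryGroup

end
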